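import Summits.HodgeConjecture.HodgeConjecture.Theorems.K2E3WittFrameTools      -- (this seat) T2 F1: frame slots, `h(e_p, ·)`, `g⁻¹` on frame slots, kernel_row_eq, bounds
import Literature.NumberTheory.Automorphic.UnitaryGroupIsotropicLineElements     -- ★ `hermForm_single_single`, `hermForm` calculus
import HarnessLib

/-!
# The NEAR-MAXIMAL FRAME PIVOT for `U(σ, wittFormOn e Han)` with an arbitrary anisotropic kernel (crux H413, U12-g ∕ 13a road A, hand (T2) — `m = 2`, wild)

Cell `hodgecm-mathlib`, Track B «K2-LIT», line `K2_E3_EllipticInputs`, 13a road A (line lead K2E3-p10 (g3), RULINGS #13); seat K2E3-p09 (g3).  THEOREMS ONLY;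
`--supports stmt-HodgeConjecture-24833 --as helper`.

At a WILDLY ramified place with a 2-dimensional anisotropic kernel the maximal entry of `g ∈ U(σ, W)` may sit OFF the frame × frame slots (explicit example over `ℚ₂(√2)`,
`W = H ⊥ ⟨1, −3⟩`, `g = t n t⁻¹`: `‖g‖ = |√2|⁻¹`, all frame × frame entries of `g` and `g⁻¹` integral — K2 bus 2026-09-04T02:32Z), so the exact (integral) pivoting of ★ p856626
fails.  This file proves the BOUNDED substitute: with ONE constant `B ≥ 1` bounding the kernel (`v(Han_{uu′}) ≤ B`) and its COERCIVITY defect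
(`v(z_u)² ≤ B · v(Han(z, z))`, ★ `exists_forall_v_sq_le_v_hermForm_self` over a local field), every `g ∈ U(σ, W)` satisfies

  `‖g‖² ≤ max (B², B⁴ · M_frame²)`,  `M_frame` = the maximal valuation of a frame × frame entry      (`sq_le_of_frame_bound`),

hence (`exists_frame_pivot`) EITHER `g` is `B`-bounded OR some frame × frame entry `g_{st}` is within the factor `B²` of the maximum.  Ingredients: the split
`h(w, w′) = Σ_frame σ(w_p) w′_{rev p} + Han(w_ker, w′_ker)` (§1), coercivity on the columns of `g` (frame columns are isotropic, kernel columns have length `Han_{uu}`),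
and the frame-row kernel entries of `g` read off the kernel part of a frame column of `g⁻¹` (★ F1 `kernel_row_eq`).

HONEST LABEL: structure lemma; HC_CM is proved only modulo the 7 printed citations (2 remaining named inputs: hLiu418 = stmt-HodgeConjecture-24832, h413 =
stmt-HodgeConjecture-24833) until rung 0 closes.

References: F. Bruhat, J. Tits, *Groupes réductifs sur un corps local I* (1972), (4.4.3); V. Platonov, A. Rapinchuk, *Algebraic Groups and Number Theory* (1994), §3.1
Thm. 3.1 (anisotropic ⟹ compact, coercivity); J. Dieudonné, *La géométrie des groupes classiques* (1971), Chap. I §11.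
-/

set_option autoImplicit false
-- the mandated namespace repeats `HodgeConjecture.HodgeConjecture`, as in every `Theorems/*.lean` of this sub-problem
set_option linter.dupNamespace false

noncomputable section

open scoped Valued WithZero Matrix MatrixGroups
open Matrix

namespace Summit.HodgeConjecture.HodgeConjecture.Cruxes.H413.K2E3WittBoundedPivot

open Literature.NumberTheory.Automorphic Literature.NumberTheory.Automorphic.UnitaryGroup Literature.NumberTheory.Automorphic.HermitianLattice
open K2E3LocalUnitaryWitt K2E3WittCartanUnramified K2E3WittParabolicBlocks K2E3WittFrameTools

/-! ## §1 The pairing split along frame and kernel -/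

section Split

variable {R : Type*} [CommRing R] (σ : R →+* R) {N r m : ℕ} (e : WittIndex r m ≃ Fin N)
  (hstd : ∀ x, (e x).val = Sum.elim (fun i : Fin r => i.val) (Sum.elim (fun u : Fin m => r + u.val) (fun j : Fin r => r + m + j.val)) x)
  (Han : Matrix (Fin m) (Fin m) R)

include hstd in
/-- `(W v)_p = v_{rev p}` at a frame slot. [cite: Dieudonne1971GroupesClassiques, Chap. I §11] -/
theorem wittFormOn_mulVec_frame {p : Fin N} (hp : ∀ u : Fin m, p ≠ e (Sum.inr (Sum.inl u))) (v : Fin N → R) :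
    (wittFormOn e Han *ᵥ v) p = v (Fin.rev p) := by
  rw [Matrix.mulVec, dotProduct, Finset.sum_eq_single (Fin.rev p)]
  · rw [wittFormOn_apply_of_frame e hstd Han hp, if_pos rfl, one_mul]
  · intro q _ hq; rw [wittFormOn_apply_of_frame e hstd Han hp, if_neg hq, zero_mul]
  · exact fun h => absurd (Finset.mem_univ _) h

/-- `(W v)_{u} = (Han v_ker)_u` at a kernel slot. [cite: Dieudonne1971GroupesClassiques, Chap. I §11] -/
theorem wittFormOn_mulVec_kernel (u : Fin m) (v : Fin N → R) :
    (wittFormOn e Han *ᵥ v) (e (Sum.inr (Sum.inl u))) = ∑ u' : Fin m, Han u u' * v (e (Sum.inr (Sum.inl u'))) := by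
  rw [Matrix.mulVec, dotProduct, ← Equiv.sum_comp e]
  rw [← Finset.sum_subset (Finset.subset_univ (Finset.univ.image (fun u' : Fin m => (Sum.inr (Sum.inl u') : WittIndex r m))))]
  · rw [Finset.sum_image (fun a _ b _ h => by simpa using h)]
    exact Finset.sum_congr rfl fun u' _ => by rw [wittFormOn_kernel_kernel]
  · intro x _ hx
    rcases x with i | u' | j
    · rw [wittFormOn_apply_inr_inl, e.symm_apply_apply]; exact zero_mul _
    · exact absurd (Finset.mem_image.2 ⟨u', Finset.mem_univ _, rfl⟩) hx
    · rw [wittFormOn_apply_inr_inl, e.symm_apply_apply]; exact zero_mul _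

include hstd in
/-- **The pairing of the Witt form split along frame and kernel**: `h(w, w′) = Σ_i σ(w_{e_i}) w′_{rev e_i} + Σ_j σ(w_{f_j}) w′_{rev f_j} + Han(w_ker, w′_ker)`.
[cite: Dieudonne1971GroupesClassiques, Chap. I §11] -/
theorem hermForm_witt_eq (w w' : Fin N → R) :
    hermForm σ (wittFormOn e Han) w w' =
      (∑ i : Fin r, σ (w (e (Sum.inl i))) * w' (Fin.rev (e (Sum.inl i)))) +
      (∑ j : Fin r, σ (w (e (Sum.inr (Sum.inr j)))) * w' (Fin.rev (e (Sum.inr (Sum.inr j))))) +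
      hermForm σ Han (fun u => w (e (Sum.inr (Sum.inl u)))) (fun u => w' (e (Sum.inr (Sum.inl u)))) := by
  rw [hermForm_apply, dotProduct, ← Equiv.sum_comp e, Fintype.sum_sum_type, Fintype.sum_sum_type, add_assoc]
  congr 1
  · refine Finset.sum_congr rfl fun i _ => ?_
    rw [Function.comp_apply, wittFormOn_mulVec_frame e hstd Han (fun u h => Sum.inl_ne_inr (e.injective h))]
  · rw [add_comm]
    congr 1
    · refine Finset.sum_congr rfl fun j _ => ?_
      rw [Function.comp_apply, wittFormOn_mulVec_frame e hstd Han (fun u h => by have := e.injective h; simp at this)]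
    · rw [hermForm_apply, dotProduct]
      refine Finset.sum_congr rfl fun u _ => ?_
      rw [Function.comp_apply, Function.comp_apply, wittFormOn_mulVec_kernel]
      rfl

end Split

/-! ## §2 Valuation consequences: coercivity on a vector with bounded frame part -/

section Bounds

variable {K : Type*} [Field K] [Valued K ℤᵐ⁰] (σ : K →+* K) {N r m : ℕ} (e : WittIndex r m ≃ Fin N)
  (hstd : ∀ x, (e x).val = Sum.elim (fun i : Fin r => i.val) (Sum.elim (fun u : Fin m => r + u.val) (fun j : Fin r => r + m + j.val)) x)
  (Han : Matrix (Fin m) (Fin m) K)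

omit [Valued K ℤᵐ⁰] in
/-- `a ≤ b` from `a² ≤ b²` in `ℤᵐ⁰`. [folklore] -/
theorem le_of_mul_self_le {a b : ℤᵐ⁰} (h : a * a ≤ b * b) : a ≤ b := by
  by_contra hlt
  push Not at hlt
  have ha0 : a ≠ 0 := ne_of_gt (lt_of_le_of_lt zero_le hlt)
  have h1 : a * a ≤ a * b := h.trans (mul_le_mul' hlt.le le_rfl)
  have h2 : a⁻¹ * (a * a) ≤ a⁻¹ * (a * b) := mul_le_mul' le_rfl h1
  rw [inv_mul_cancel_left₀ ha0, inv_mul_cancel_left₀ ha0] at h2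
  exact not_lt.2 h2 hlt

include hstd in
/-- **The kernel part of a vector is controlled by its length and its frame part**: if `v(w_p) ≤ F` on the frame slots then
`v(Han(w_ker, w_ker)) ≤ max (v(h(w, w))) (F · F)`. [cite: PlatonovRapinchuk1994, §3.1] -/
theorem v_hermForm_kernel_le (hvσ : ∀ x, Valued.v (σ x) = Valued.v x) (w : Fin N → K) {F : ℤᵐ⁰}
    (hF : ∀ p : Fin N, (∀ u : Fin m, p ≠ e (Sum.inr (Sum.inl u))) → Valued.v (w p) ≤ F) :
    Valued.v (hermForm σ Han (fun u => w (e (Sum.inr (Sum.inl u)))) (fun u => w (e (Sum.inr (Sum.inl u))))) ≤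
      max (Valued.v (hermForm σ (wittFormOn e Han) w w)) (F * F) := by
  have hsplit := hermForm_witt_eq σ e hstd Han w w
  have hfi : ∀ i : Fin r, ∀ u : Fin m, e (Sum.inl i) ≠ e (Sum.inr (Sum.inl u)) := fun i u h => Sum.inl_ne_inr (e.injective h)
  have hfj : ∀ j : Fin r, ∀ u : Fin m, e (Sum.inr (Sum.inr j)) ≠ e (Sum.inr (Sum.inl u)) := fun j u h => by have := e.injective h; simp at this
  have hS1 : Valued.v (∑ i : Fin r, σ (w (e (Sum.inl i))) * w (Fin.rev (e (Sum.inl i)))) ≤ F * F := by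
    refine Valued.v.map_sum_le fun i _ => ?_
    rw [map_mul, hvσ]
    exact mul_le_mul' (hF _ (hfi i)) (hF _ (frame_rev e hstd (hfi i)))
  have hS2 : Valued.v (∑ j : Fin r, σ (w (e (Sum.inr (Sum.inr j)))) * w (Fin.rev (e (Sum.inr (Sum.inr j))))) ≤ F * F := by
    refine Valued.v.map_sum_le fun j _ => ?_
    rw [map_mul, hvσ]
    exact mul_le_mul' (hF _ (hfj j)) (hF _ (frame_rev e hstd (hfj j)))
  have heq : hermForm σ Han (fun u => w (e (Sum.inr (Sum.inl u)))) (fun u => w (e (Sum.inr (Sum.inl u)))) =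
      hermForm σ (wittFormOn e Han) w w - (∑ i : Fin r, σ (w (e (Sum.inl i))) * w (Fin.rev (e (Sum.inl i)))) -
        (∑ j : Fin r, σ (w (e (Sum.inr (Sum.inr j)))) * w (Fin.rev (e (Sum.inr (Sum.inr j))))) := by
    rw [hsplit]; ring
  rw [heq]
  refine (Valued.v.map_sub _ _).trans (max_le ((Valued.v.map_sub _ _).trans (max_le (le_max_left _ _) ?_)) ?_)
  · exact hS1.trans (le_max_right _ _)
  · exact hS2.trans (le_max_right _ _)

include hstd in
/-- **Coercivity applied**: `v(w_u)² ≤ B · max (v(h(w, w))) (F · F)` for every kernel slot `u`, if `v(z_u)² ≤ B · v(Han(z, z))` for all `z` and `v(w_p) ≤ F` on the frame.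
[cite: PlatonovRapinchuk1994, §3.1 Thm. 3.1] -/
theorem v_kernel_sq_le (hvσ : ∀ x, Valued.v (σ x) = Valued.v x) {B : ℤᵐ⁰}
    (hcoer : ∀ (z : Fin m → K) (u : Fin m), Valued.v (z u) * Valued.v (z u) ≤ B * Valued.v (hermForm σ Han z z)) (w : Fin N → K) {F : ℤᵐ⁰}
    (hF : ∀ p : Fin N, (∀ u : Fin m, p ≠ e (Sum.inr (Sum.inl u))) → Valued.v (w p) ≤ F) (u : Fin m) :
    Valued.v (w (e (Sum.inr (Sum.inl u)))) * Valued.v (w (e (Sum.inr (Sum.inl u)))) ≤ B * max (Valued.v (hermForm σ (wittFormOn e Han) w w)) (F * F) :=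
  (hcoer (fun u => w (e (Sum.inr (Sum.inl u)))) u).trans (mul_le_mul' le_rfl (v_hermForm_kernel_le σ e hstd Han hvσ w hF))

end Bounds

/-! ## §3 The columns of an element of `U(σ, W)` and the pivot -/

section Pivot

variable {K : Type*} [Field K] [Valued K ℤᵐ⁰] (σ : K →+* K) {N r m : ℕ} (e : WittIndex r m ≃ Fin N)
  (hstd : ∀ x, (e x).val = Sum.elim (fun i : Fin r => i.val) (Sum.elim (fun u : Fin m => r + u.val) (fun j : Fin r => r + m + j.val)) x)
  (Han : Matrix (Fin m) (Fin m) K) (hvσ : ∀ x, Valued.v (σ x) = Valued.v x) {B : ℤᵐ⁰} (hB1 : 1 ≤ B)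
  (hHanB : ∀ u u', Valued.v (Han u u') ≤ B)
  (hcoer : ∀ (z : Fin m → K) (u : Fin m), Valued.v (z u) * Valued.v (z u) ≤ B * Valued.v (hermForm σ Han z z))

omit [Valued K ℤᵐ⁰] in
include hstd in
/-- The length of the column `g e_t`: `h(g e_t, g e_t) = W_{tt}`. [cite: Rogawski1990, §1.9] -/
theorem hermForm_col_col (g : unitaryGroupOfForm σ (wittFormOn e Han)) (t : Fin N) :
    hermForm σ (wittFormOn e Han) (fun i => ((g : GL (Fin N) K) : Matrix (Fin N) (Fin N) K) i t) (fun i => ((g : GL (Fin N) K) : Matrix (Fin N) (Fin N) K) i t) =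
      wittFormOn e Han t t := by
  have _ := hstd
  rw [← K2E3WittFrameTools.mulVec_single_one, hermForm_mulVec σ (mem_unitaryGroupOfForm_iff.1 g.2), hermForm_single_single]

include hstd hvσ hcoer in
/-- **(kernel row, frame column)**: `v(g_{u,t})² ≤ B · M_ff²` for a frame slot `t`, `M_ff` bounding the frame × frame entries of `g` (the column `g e_t` is ISOTROPIC).
[cite: BruhatTits1972, (4.4.3)] [cite: PlatonovRapinchuk1994, §3.1] -/
theorem v_kernel_frame_sq_le (g : unitaryGroupOfForm σ (wittFormOn e Han)) {Mff : ℤᵐ⁰}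
    (hff : ∀ p q : Fin N, (∀ u : Fin m, p ≠ e (Sum.inr (Sum.inl u))) → (∀ u : Fin m, q ≠ e (Sum.inr (Sum.inl u))) →
      Valued.v (((g : GL (Fin N) K) : Matrix (Fin N) (Fin N) K) p q) ≤ Mff)
    {t : Fin N} (ht : ∀ u : Fin m, t ≠ e (Sum.inr (Sum.inl u))) (u : Fin m) :
    Valued.v (((g : GL (Fin N) K) : Matrix (Fin N) (Fin N) K) (e (Sum.inr (Sum.inl u))) t) *
      Valued.v (((g : GL (Fin N) K) : Matrix (Fin N) (Fin N) K) (e (Sum.inr (Sum.inl u))) t) ≤ B * (Mff * Mff) := by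
  have h := v_kernel_sq_le σ e hstd Han hvσ hcoer (fun i => ((g : GL (Fin N) K) : Matrix (Fin N) (Fin N) K) i t) (F := Mff) (fun p hp => hff p t hp ht) u
  rw [hermForm_col_col σ e hstd Han g t, wittFormOn_apply_of_frame e hstd Han ht, if_neg (ne_rev_of_frame e hstd ht), map_zero] at h
  rwa [max_eq_right zero_le] at h

include hstd hvσ hcoer hHanB in
/-- **(kernel row, kernel column)**: `v(g_{u,u₀})² ≤ B · max (B, M_fk²)`, `M_fk` bounding the frame-row entries of the kernel columns (the column `g u₀` has
length `Han_{u₀u₀}`). [cite: PlatonovRapinchuk1994, §3.1] -/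
theorem v_kernel_kernel_sq_le (g : unitaryGroupOfForm σ (wittFormOn e Han)) {Mfk : ℤᵐ⁰}
    (hfk : ∀ (p : Fin N) (u₀ : Fin m), (∀ u : Fin m, p ≠ e (Sum.inr (Sum.inl u))) →
      Valued.v (((g : GL (Fin N) K) : Matrix (Fin N) (Fin N) K) p (e (Sum.inr (Sum.inl u₀)))) ≤ Mfk) (u u₀ : Fin m) :
    Valued.v (((g : GL (Fin N) K) : Matrix (Fin N) (Fin N) K) (e (Sum.inr (Sum.inl u))) (e (Sum.inr (Sum.inl u₀)))) *
      Valued.v (((g : GL (Fin N) K) : Matrix (Fin N) (Fin N) K) (e (Sum.inr (Sum.inl u))) (e (Sum.inr (Sum.inl u₀)))) ≤ B * max B (Mfk * Mfk) := by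
  have h := v_kernel_sq_le σ e hstd Han hvσ hcoer (fun i => ((g : GL (Fin N) K) : Matrix (Fin N) (Fin N) K) i (e (Sum.inr (Sum.inl u₀)))) (F := Mfk)
    (fun p hp => hfk p u₀ hp) u
  rw [hermForm_col_col σ e hstd Han g, wittFormOn_kernel_kernel] at h
  exact h.trans (mul_le_mul' le_rfl (max_le_max (hHanB u₀ u₀) le_rfl))

include hstd hvσ in
/-- The frame × frame entries of `g⁻¹` are bounded like those of `g` (`(g⁻¹)_{ij} = σ(g_{rev j, rev i})`). [cite: Rogawski1990, §1.9] -/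
theorem v_inv_frame_frame_le (hHan : IsUnit Han.det) (g : unitaryGroupOfForm σ (wittFormOn e Han)) {Mff : ℤᵐ⁰}
    (hff : ∀ p q : Fin N, (∀ u : Fin m, p ≠ e (Sum.inr (Sum.inl u))) → (∀ u : Fin m, q ≠ e (Sum.inr (Sum.inl u))) →
      Valued.v (((g : GL (Fin N) K) : Matrix (Fin N) (Fin N) K) p q) ≤ Mff)
    (p q : Fin N) (hp : ∀ u : Fin m, p ≠ e (Sum.inr (Sum.inl u))) (hq : ∀ u : Fin m, q ≠ e (Sum.inr (Sum.inl u))) :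
    Valued.v ((((g⁻¹ : unitaryGroupOfForm σ (wittFormOn e Han)) : GL (Fin N) K) : Matrix (Fin N) (Fin N) K) p q) ≤ Mff := by
  rw [inv_apply_frame_frame σ e hstd Han hHan g hp hq, hvσ]
  exact hff _ _ (frame_rev e hstd hq) (frame_rev e hstd hp)

include hstd hvσ hcoer hHanB in
/-- **(frame row, kernel column)**: `v(g_{p,u})² ≤ B³ · M_ff²` — the kernel part of the frame row `p` of `g` is `Han` of the kernel part of the frame column `rev p` of
`g⁻¹` (★ F1 `kernel_row_eq`), which is isotropic. [cite: Rogawski1990, §1.9] [cite: PlatonovRapinchuk1994, §3.1] -/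
theorem v_frame_kernel_sq_le (hHan : IsUnit Han.det) (g : unitaryGroupOfForm σ (wittFormOn e Han)) {Mff : ℤᵐ⁰}
    (hff : ∀ p q : Fin N, (∀ u : Fin m, p ≠ e (Sum.inr (Sum.inl u))) → (∀ u : Fin m, q ≠ e (Sum.inr (Sum.inl u))) →
      Valued.v (((g : GL (Fin N) K) : Matrix (Fin N) (Fin N) K) p q) ≤ Mff)
    {p : Fin N} (hp : ∀ u : Fin m, p ≠ e (Sum.inr (Sum.inl u))) (u : Fin m) :
    Valued.v (((g : GL (Fin N) K) : Matrix (Fin N) (Fin N) K) p (e (Sum.inr (Sum.inl u)))) *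
      Valued.v (((g : GL (Fin N) K) : Matrix (Fin N) (Fin N) K) p (e (Sum.inr (Sum.inl u)))) ≤ B * B * B * (Mff * Mff) := by
  -- the largest kernel entry `X` of the frame column `rev p` of `g⁻¹`
  have hne : (Finset.univ : Finset (Fin m)).Nonempty := ⟨u, Finset.mem_univ _⟩
  obtain ⟨u₁, -, hu₁⟩ := Finset.exists_max_image Finset.univ
    (fun u' => Valued.v ((((g⁻¹ : unitaryGroupOfForm σ (wittFormOn e Han)) : GL (Fin N) K) : Matrix (Fin N) (Fin N) K) (e (Sum.inr (Sum.inl u'))) (Fin.rev p))) hne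
  set X := Valued.v ((((g⁻¹ : unitaryGroupOfForm σ (wittFormOn e Han)) : GL (Fin N) K) : Matrix (Fin N) (Fin N) K) (e (Sum.inr (Sum.inl u₁))) (Fin.rev p)) with hX
  have hlin : Valued.v (((g : GL (Fin N) K) : Matrix (Fin N) (Fin N) K) p (e (Sum.inr (Sum.inl u)))) ≤ B * X :=
    v_kernel_entry_le σ e hstd Han hvσ g hp hHanB (fun u' => hu₁ u' (Finset.mem_univ _)) u
  have hXsq : X * X ≤ B * (Mff * Mff) :=
    v_kernel_frame_sq_le σ e hstd Han hvσ hcoer g⁻¹ (v_inv_frame_frame_le σ e hstd Han hvσ hHan g hff) (frame_rev e hstd hp) u₁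
  calc _ ≤ (B * X) * (B * X) := mul_le_mul' hlin hlin
    _ = B * B * (X * X) := by ac_rfl
    _ ≤ B * B * (B * (Mff * Mff)) := mul_le_mul' le_rfl hXsq
    _ = B * B * B * (Mff * Mff) := by ac_rfl

include hstd hvσ hcoer hHanB hB1 in
/-- **`‖g‖² ≤ max (B², B⁴ · M_ff²)`**: every entry of `g ∈ U(σ, W)` is controlled by the frame × frame entries, up to the defect `B`.
[cite: BruhatTits1972, (4.4.3)] [cite: PlatonovRapinchuk1994, §3.1 Thm. 3.1] -/
theorem sq_le_of_frame_bound (hHan : IsUnit Han.det) (g : unitaryGroupOfForm σ (wittFormOn e Han)) {Mff : ℤᵐ⁰}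
    (hff : ∀ p q : Fin N, (∀ u : Fin m, p ≠ e (Sum.inr (Sum.inl u))) → (∀ u : Fin m, q ≠ e (Sum.inr (Sum.inl u))) →
      Valued.v (((g : GL (Fin N) K) : Matrix (Fin N) (Fin N) K) p q) ≤ Mff) (p q : Fin N) :
    Valued.v (((g : GL (Fin N) K) : Matrix (Fin N) (Fin N) K) p q) * Valued.v (((g : GL (Fin N) K) : Matrix (Fin N) (Fin N) K) p q) ≤
      max (B * B) ((B * B * Mff) * (B * B * Mff)) := by
  have hB2 : 1 ≤ B * B := one_le_mul hB1 hB1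
  have hB3 : 1 ≤ B * B * B := one_le_mul hB2 hB1
  have hmono : Mff * Mff ≤ (B * B * Mff) * (B * B * Mff) := by
    calc Mff * Mff = 1 * (Mff * Mff) := (one_mul _).symm
      _ ≤ (B * B * (B * B)) * (Mff * Mff) := mul_le_mul' (one_le_mul hB2 hB2) le_rfl
      _ = (B * B * Mff) * (B * B * Mff) := by ac_rfl
  by_cases hp : ∀ u : Fin m, p ≠ e (Sum.inr (Sum.inl u))
  · by_cases hq : ∀ u : Fin m, q ≠ e (Sum.inr (Sum.inl u))
    · exact ((mul_le_mul' (hff p q hp hq) (hff p q hp hq)).trans hmono).trans (le_max_right _ _)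
    · push Not at hq
      obtain ⟨u, rfl⟩ := hq
      refine ((v_frame_kernel_sq_le σ e hstd Han hvσ hHanB hcoer hHan g hff hp u).trans ?_).trans (le_max_right _ _)
      calc B * B * B * (Mff * Mff) ≤ B * B * B * B * (Mff * Mff) := by
            rw [mul_assoc (B * B * B) B]; exact mul_le_mul' le_rfl (le_mul_of_one_le_left' hB1)
        _ = (B * B * Mff) * (B * B * Mff) := by ac_rfl
  · push Not at hp
    obtain ⟨u, rfl⟩ := hp
    by_cases hq : ∀ u : Fin m, q ≠ e (Sum.inr (Sum.inl u))
    · refine ((v_kernel_frame_sq_le σ e hstd Han hvσ hcoer g hff hq u).trans ?_).trans (le_max_right _ _)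
      calc B * (Mff * Mff) ≤ B * B * B * B * (Mff * Mff) := mul_le_mul' (by
              calc B = 1 * B := (one_mul B).symm
                _ ≤ B * B * B * B := mul_le_mul' hB3 le_rfl) le_rfl
        _ = (B * B * Mff) * (B * B * Mff) := by ac_rfl
    · push Not at hq
      obtain ⟨u₀, rfl⟩ := hq
      -- the frame-row bound of the kernel columns: `Mfk² ≤ B³ Mff²`, with `Mfk` realised as a maximum (or no frame rows at all)
      by_cases hr : ∃ p₀ : Fin N, ∀ u' : Fin m, p₀ ≠ e (Sum.inr (Sum.inl u'))
      · obtain ⟨p₀, hp₀⟩ := hr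
        set S : Finset (Fin N × Fin m) := (Finset.univ.filter fun p : Fin N => ∀ u' : Fin m, p ≠ e (Sum.inr (Sum.inl u'))) ×ˢ Finset.univ with hS
        have hSne : S.Nonempty := ⟨(p₀, u₀), by rw [hS, Finset.mem_product]; exact ⟨Finset.mem_filter.2 ⟨Finset.mem_univ _, hp₀⟩, Finset.mem_univ _⟩⟩
        obtain ⟨⟨p₁, u₁⟩, hmem, hmax⟩ := Finset.exists_max_image S
          (fun x : Fin N × Fin m => Valued.v (((g : GL (Fin N) K) : Matrix (Fin N) (Fin N) K) x.1 (e (Sum.inr (Sum.inl x.2))))) hSne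
        have hp₁ : ∀ u' : Fin m, p₁ ≠ e (Sum.inr (Sum.inl u')) := by
          rw [hS, Finset.mem_product] at hmem; exact (Finset.mem_filter.1 hmem.1).2
        set Mfk := Valued.v (((g : GL (Fin N) K) : Matrix (Fin N) (Fin N) K) p₁ (e (Sum.inr (Sum.inl u₁)))) with hMfk
        have hfk : ∀ (p : Fin N) (u' : Fin m), (∀ u : Fin m, p ≠ e (Sum.inr (Sum.inl u))) →
            Valued.v (((g : GL (Fin N) K) : Matrix (Fin N) (Fin N) K) p (e (Sum.inr (Sum.inl u')))) ≤ Mfk := fun p u' hp =>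
          hmax (p, u') (by rw [hS, Finset.mem_product]; exact ⟨Finset.mem_filter.2 ⟨Finset.mem_univ _, hp⟩, Finset.mem_univ _⟩)
        have h1 := v_kernel_kernel_sq_le σ e hstd Han hvσ hHanB hcoer g hfk u u₀
        have h2 : Mfk * Mfk ≤ B * B * B * (Mff * Mff) := v_frame_kernel_sq_le σ e hstd Han hvσ hHanB hcoer hHan g hff hp₁ u₁
        refine h1.trans ?_
        rw [← max_mul_mul_left]
        refine max_le_max le_rfl ?_
        calc B * (Mfk * Mfk) ≤ B * (B * B * B * (Mff * Mff)) := mul_le_mul' le_rfl h2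
          _ = (B * B * Mff) * (B * B * Mff) := by ac_rfl
      · -- no frame slots: the column has bounded length and no frame part
        push Not at hr
        have hfk : ∀ (p : Fin N) (u' : Fin m), (∀ u : Fin m, p ≠ e (Sum.inr (Sum.inl u))) →
            Valued.v (((g : GL (Fin N) K) : Matrix (Fin N) (Fin N) K) p (e (Sum.inr (Sum.inl u')))) ≤ 0 := fun p u' hp => by
          obtain ⟨u'', hu''⟩ := hr p; exact absurd hu'' (hp u'')
        have h1 := v_kernel_kernel_sq_le σ e hstd Han hvσ hHanB hcoer g hfk u u₀
        rw [mul_zero, max_eq_left zero_le] at h1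
        exact h1.trans (le_max_left _ _)

include hstd hvσ hcoer hHanB hB1 in
/-- **THE NEAR-MAXIMAL FRAME PIVOT**: either every entry of `g ∈ U(σ, W)` is bounded by `B`, or there is a frame × frame slot `(s, t)` with `g_{st} ≠ 0` and
`v(g_{pq}) ≤ B² · v(g_{st})` for ALL `(p, q)`. [cite: BruhatTits1972, (4.4.3)] [cite: PlatonovRapinchuk1994, §3.1 Thm. 3.1] -/
theorem exists_frame_pivot (hHan : IsUnit Han.det) (g : unitaryGroupOfForm σ (wittFormOn e Han)) :
    (∀ p q, Valued.v (((g : GL (Fin N) K) : Matrix (Fin N) (Fin N) K) p q) ≤ B) ∨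
      ∃ s t : Fin N, (∀ u : Fin m, s ≠ e (Sum.inr (Sum.inl u))) ∧ (∀ u : Fin m, t ≠ e (Sum.inr (Sum.inl u))) ∧
        ((g : GL (Fin N) K) : Matrix (Fin N) (Fin N) K) s t ≠ 0 ∧
        ∀ p q, Valued.v (((g : GL (Fin N) K) : Matrix (Fin N) (Fin N) K) p q) ≤ B * B * Valued.v (((g : GL (Fin N) K) : Matrix (Fin N) (Fin N) K) s t) := by
  set A : Matrix (Fin N) (Fin N) K := ((g : GL (Fin N) K) : Matrix (Fin N) (Fin N) K) with hA
  by_cases hr : ∃ p₀ : Fin N, ∀ u' : Fin m, p₀ ≠ e (Sum.inr (Sum.inl u'))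
  · obtain ⟨p₀, hp₀⟩ := hr
    set S : Finset (Fin N × Fin N) := (Finset.univ.filter fun p : Fin N => ∀ u' : Fin m, p ≠ e (Sum.inr (Sum.inl u'))) ×ˢ
      (Finset.univ.filter fun p : Fin N => ∀ u' : Fin m, p ≠ e (Sum.inr (Sum.inl u'))) with hS
    have hmemS : ∀ x : Fin N × Fin N, x ∈ S ↔ (∀ u' : Fin m, x.1 ≠ e (Sum.inr (Sum.inl u'))) ∧ ∀ u' : Fin m, x.2 ≠ e (Sum.inr (Sum.inl u')) := fun x => by
      rw [hS, Finset.mem_product, Finset.mem_filter, Finset.mem_filter]; simp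
    obtain ⟨⟨s, t⟩, hmem, hmax⟩ := Finset.exists_max_image S (fun x : Fin N × Fin N => Valued.v (A x.1 x.2)) ⟨(p₀, p₀), (hmemS _).2 ⟨hp₀, hp₀⟩⟩
    obtain ⟨hs, ht⟩ := (hmemS _).1 hmem
    have hff : ∀ p q : Fin N, (∀ u : Fin m, p ≠ e (Sum.inr (Sum.inl u))) → (∀ u : Fin m, q ≠ e (Sum.inr (Sum.inl u))) →
        Valued.v (A p q) ≤ Valued.v (A s t) := fun p q hp hq => hmax (p, q) ((hmemS _).2 ⟨hp, hq⟩)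
    have hsq := sq_le_of_frame_bound σ e hstd Han hvσ hB1 hHanB hcoer hHan g hff
    rcases le_total ((B * B * Valued.v (A s t)) * (B * B * Valued.v (A s t))) (B * B) with hle | hle
    · left
      intro p q
      have h := hsq p q
      rw [max_eq_left hle] at h
      exact le_of_mul_self_le h
    · right
      have hst0 : A s t ≠ 0 := by
        intro h0
        rw [h0, map_zero, mul_zero, mul_zero, le_zero_iff, mul_eq_zero] at hle
        have hB0 : B ≠ 0 := ne_of_gt (lt_of_lt_of_le zero_lt_one hB1)
        exact hB0 (hle.elim id id)
      refine ⟨s, t, hs, ht, hst0, fun p q => ?_⟩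
      have h := hsq p q
      rw [max_eq_right hle] at h
      exact le_of_mul_self_le h
  · left
    push Not at hr
    intro p q
    have hff : ∀ p q : Fin N, (∀ u : Fin m, p ≠ e (Sum.inr (Sum.inl u))) → (∀ u : Fin m, q ≠ e (Sum.inr (Sum.inl u))) → Valued.v (A p q) ≤ 0 :=
      fun p q hp _ => by obtain ⟨u, hu⟩ := hr p; exact absurd hu (hp u)
    have h := sq_le_of_frame_bound σ e hstd Han hvσ hB1 hHanB hcoer hHan g hff p q
    rw [mul_zero, mul_zero, max_eq_left zero_le] at h
    exact le_of_mul_self_le h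

end Pivot

end Summit.HodgeConjecture.HodgeConjecture.Cruxes.H413.K2E3WittBoundedPivot

end
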